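import Summits.ResolutionOfSingularities.ResolutionOfSingularities.Theorems.FrobeniusLadderFInjectiveMacaulayficationS2ModificationAffine
import Mathlib.RingTheory.Ideal.Basic
import Mathlib.LinearAlgebra.Finsupp.LinearCombination
import HarnessLib

/-!
# The affine S₂-modification algebra depends only on the closed set: generator independence up to radical
# (crux `FInjectiveMacaulayfication` stmt-ResolutionOfSingularities-15315, chain w45a, hole #3γ, FC′ rung r2 input S-S2; sequel («item 0» of
# `L/res-L1-w45a-stub-2/S2ModificationAffine-PLAN.md`) to `…S2ModificationAffine` p548522; seat res-L1-w45a-stub-2)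

[OURS · L1 W4.5a] Support file (`--supports stmt-ResolutionOfSingularities-15315 --as helper`); NOT a statement of any manuscript; no named fact;
no definitions; AI-written (AI review is weaker than expert review).

`A′ = Ā ∩ ⋂_{f ∈ s} A[1/f]` (`S2ModificationAffine.s2Mod`) is the ring of sections of the normalisation over the open `Spec A ∖ V(s)`; this file
proves the ring-level form of «`A′` depends only on `V(s)`»: if `g ≠ 0` has a power in the ideal `(s)` — i.e. `D(g) ⊆ ⋃_{f ∈ s} D(f)` — then
every element of `⋂_{f ∈ s} A[1/f]` already lies in `A[1/g]` (clear denominators uniformly, `x·f^N ∈ A` for all `f ∈ s`, and use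
`(Σ c_f f)^{|s|·N+1} ∈ ((c_f f)^{N+1} : f ∈ s)`, Mathlib's `Ideal.sum_pow_mem_span_pow`). Consequently two finite generating sets of ideals
with the same radical give the same `A′`.

* `mul_pow_mem_range_of_mem` — `x ∈ A′`, `f ∈ s` ⟹ `f^{n_f}·x ∈ A` for the exponent of `exists_eq_mul_inv_pow`;
* `s2Mod_le_awaySub_of_pow_mem_span` — `g ≠ 0`, `g^m ∈ (s)` ⟹ `A′ ≤ A[1/g]`;
* `s2Mod_le_s2Mod_of_pow_mem_span` — `(∀ g ∈ s', ∃ m, g^m ∈ (s))` ⟹ `s2Mod s ≤ s2Mod s'`; `s2Mod_eq_of_radical` — equal radicals ⟹ equal `A′`.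

[folklore]
-/

-- single-problem summit: the doubled namespace component is forced
set_option linter.dupNamespace false

noncomputable section

namespace Summit.ResolutionOfSingularities.ResolutionOfSingularities.Theorems.FInjectiveMacaulayfication.S2ModificationAffineRadical

open Summit.ResolutionOfSingularities.ResolutionOfSingularities.Theorems.FInjectiveMacaulayfication
open S2ModificationAffine

variable (A : Type) [CommRing A] [IsDomain A] (K : Type) [Field K] [Algebra A K] [IsFractionRing A K]

omit [IsDomain A] in
/-- `algebraMap A K y ≠ 0` for `y ≠ 0` (`A` embeds in its fraction field). [folklore] -/
theorem algebraMap_ne_zero {y : A} (hy : y ≠ 0) : algebraMap A K y ≠ 0 :=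
  fun h => hy ((injective_iff_map_eq_zero (algebraMap A K)).mp (IsFractionRing.injective A K) _ h)

/-- Clearing one denominator: if `x = a · (fⁿ)⁻¹` then `fⁿ · x = a` in `K`. [folklore] -/
theorem pow_mul_eq_of_eq_mul_inv {f a : A} (hf : f ≠ 0) {n : ℕ} {x : K}
    (hx : x = algebraMap A K a * (algebraMap A K (f ^ n))⁻¹) : algebraMap A K (f ^ n) * x = algebraMap A K a := by
  rw [hx, mul_comm, mul_assoc, inv_mul_cancel₀ (algebraMap_ne_zero A K (pow_ne_zero n hf)), mul_one]

/-- **`A′ ≤ A[1/g]` whenever a power of `g ≠ 0` lies in the ideal `(s)`** — the elements of `⋂_{f ∈ s} A[1/f]` are sections over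
`D(g) ⊆ ⋃ D(f)`. [folklore] -/
theorem s2Mod_le_awaySub_of_pow_mem_span (s : Finset A) (hs : ∀ f ∈ s, f ≠ 0) (g : A) (hg : g ≠ 0) (m : ℕ)
    (hgm : g ^ m ∈ Ideal.span (s : Set A)) : s2Mod A K s hs ≤ awaySub A K g hg := by
  intro x hx
  classical
  -- uniform exponent: `f ^ n f · x ∈ A` for every `f ∈ s`, and `N ≥ n f`
  choose a n hxeq using fun (f : A) (hf : f ∈ s) => exists_eq_mul_inv_pow A K s hs hx f hf
  set N : ℕ := ∑ f ∈ s.attach, n f.1 f.2 with hN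
  have hnle : ∀ (f : A) (hf : f ∈ s), n f hf ≤ N := fun f hf =>
    Finset.single_le_sum (f := fun g : {g // g ∈ s} => n g.1 g.2) (fun _ _ => Nat.zero_le _) (Finset.mem_attach s ⟨f, hf⟩)
  -- the set of `y ∈ A` with `y · x ∈ A` contains the ideal generated by the `(c f · f) ^ (N+1)`
  obtain ⟨c, -, hc⟩ := Submodule.mem_span_finset.mp hgm
  simp only [smul_eq_mul] at hc
  have hpow : (g ^ m) ^ (s.card * N + 1) ∈ Ideal.span ((fun f => (c f * f) ^ (N + 1)) '' (s : Set A)) := by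
    rw [← hc]
    exact Ideal.sum_pow_mem_span_pow s (fun f => c f * f) N
  have key : ∀ y ∈ Ideal.span ((fun f => (c f * f) ^ (N + 1)) '' (s : Set A)), ∃ b : A, algebraMap A K y * x = algebraMap A K b := by
    intro y hy
    refine Submodule.span_induction ?_ ?_ ?_ ?_ hy
    · rintro _ ⟨f, hf, rfl⟩
      have hf' : f ∈ s := hf
      refine ⟨c f ^ (N + 1) * f ^ (N + 1 - n f hf') * a f hf', ?_⟩
      have hsplit : (c f * f) ^ (N + 1) = c f ^ (N + 1) * f ^ (N + 1 - n f hf') * f ^ n f hf' := by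
        rw [mul_pow, mul_assoc, ← pow_add, Nat.sub_add_cancel (le_trans (hnle f hf') (Nat.le_succ N))]
      show algebraMap A K ((c f * f) ^ (N + 1)) * x = _
      rw [hsplit, map_mul, mul_assoc, pow_mul_eq_of_eq_mul_inv A K (hs f hf') (hxeq f hf'), ← map_mul]
    · exact ⟨0, by simp⟩
    · rintro y z - - ⟨b₁, hb₁⟩ ⟨b₂, hb₂⟩
      exact ⟨b₁ + b₂, by rw [map_add, add_mul, hb₁, hb₂, map_add]⟩
    · rintro r y - ⟨b, hb⟩
      exact ⟨r * b, by rw [smul_eq_mul, map_mul, mul_assoc, hb, ← map_mul]⟩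
  obtain ⟨b, hb⟩ := key _ hpow
  rw [← pow_mul] at hb
  refine (mem_awaySub_iff A K g hg x).mpr ⟨b, m * (s.card * N + 1), ?_⟩
  rw [← hb, mul_comm (algebraMap A K (g ^ _)) x, mul_assoc,
    mul_inv_cancel₀ (algebraMap_ne_zero A K (pow_ne_zero _ hg)), mul_one]

/-- **Monotonicity in the closed set**: if every `g ∈ s'` has a power in `(s)` (i.e. `V(s) ⊆ V(s')`, `⋃ D(g) ⊆ ⋃ D(f)`), then
`s2Mod s ≤ s2Mod s'`. [folklore] -/
theorem s2Mod_le_s2Mod_of_pow_mem_span (s s' : Finset A) (hs : ∀ f ∈ s, f ≠ 0) (hs' : ∀ g ∈ s', g ≠ 0)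
    (h : ∀ g ∈ s', ∃ m : ℕ, g ^ m ∈ Ideal.span (s : Set A)) : s2Mod A K s hs ≤ s2Mod A K s' hs' := by
  refine le_inf (s2Mod_le_integralClosure A K s hs) (le_iInf fun g => ?_)
  obtain ⟨m, hm⟩ := h g.1 g.2
  exact s2Mod_le_awaySub_of_pow_mem_span A K s hs g.1 (hs' g.1 g.2) m hm

/-- **`A′` depends only on the radical of `(s)`**: finite generating sets of ideals with the same radical give the same S₂-modification
algebra. [folklore] -/
theorem s2Mod_eq_of_radical (s s' : Finset A) (hs : ∀ f ∈ s, f ≠ 0) (hs' : ∀ g ∈ s', g ≠ 0)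
    (h : (Ideal.span (s : Set A)).radical = (Ideal.span (s' : Set A)).radical) : s2Mod A K s hs = s2Mod A K s' hs' := by
  apply le_antisymm
  · refine s2Mod_le_s2Mod_of_pow_mem_span A K s s' hs hs' fun g hg => ?_
    have : g ∈ (Ideal.span (s : Set A)).radical := by
      rw [h]; exact Ideal.le_radical (Ideal.subset_span (Finset.mem_coe.mpr hg))
    exact this
  · refine s2Mod_le_s2Mod_of_pow_mem_span A K s' s hs' hs fun f hf => ?_
    have : f ∈ (Ideal.span (s' : Set A)).radical := by
      rw [← h]; exact Ideal.le_radical (Ideal.subset_span (Finset.mem_coe.mpr hf))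
    exact this

end Summit.ResolutionOfSingularities.ResolutionOfSingularities.Theorems.FInjectiveMacaulayfication.S2ModificationAffineRadical

end
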